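import Summits.BirchSwinnertonDyer.BirchSwinnertonDyer.Theses.LeadingTerm
import Literature.NumberTheory.EllipticCurves.ModPImageJ1728CartanProofs
import Literature.NumberTheory.EllipticCurves.SzpiroLocalDataProofs
import Literature.NumberTheory.EllipticCurves.DegreeConjectureAbcPrelims
import Mathlib.Algebra.Polynomial.SpecificDegree

/-!
# BirchSwinnertonDyer / LeadingTerm — crux `TamePinch` (stmt-BirchSwinnertonDyer-15532): negative lemmas

Kernel-checked negative knowledge behind the refutation
`Summit.BirchSwinnertonDyer.BirchSwinnertonDyer.Theorems.LeadingTermTamePinch_refuted` (file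
`Theorems/LeadingTermTamePinchRefutation.lean`), exported with public names so that planners,
provers and later refuters can import them (no statement of the route is asserted positively):

* `tamePinch_exists_smul_sqrt_neg_one_eq_neg` — complex conjugation in `Gal(ℚ̄/ℚ)`: a square root
  of `−1` in `ℚ̄` is moved to its negative by some `σ`;
* `tamePinch_not_hasSurjectiveModNGaloisRep_quartic` — **for every `D ≠ 0` and every ODD prime `p`,
  the mod-`p` representation of `E_D : y² = x³ + Dx` (`j = 1728`, CM by `ℤ[i]`) is not surjective**
  (`¬ W.HasSurjectiveModNGaloisRep p`). Proof without a Cartan case split: all squares of elements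
  of the image centralise the non-scalar `[i]|E[p]` (`exists_cmAut_quartic`,
  `exists_frame_galoisRepTorsion_rat`), hence commute pairwise, while the squares `(1 2; 0 1)`,
  `(1 0; 2 1)` of the elementary unipotents of `GL₂(𝔽_p)` do not (`4 ≠ 0`). This is the `j = 1728`
  slice, for all odd `p` at once, of the named fact
  `Literature.NumberTheory.EllipticCurves.zywina2015_cm_modEll_not_surjective` (Zywina 2015
  Prop. 1.14; Serre 1972 §4.5; Darmon–Merel 1997 Prop. 4.1 (1));
* `tamePinch_isGloballyMinimal_thirtyTwoA2` — `y² = x³ − x` (Cremona 32a2, `Δ = 64`) is a global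
  minimal model;
* `tamePinch_no_admissible_prime_thirtyTwoA2` — the admissible-prime clause of `TamePinch`
  (`∃ p ≥ 5` prime with `ρ̄_{W,p}` onto) already fails at `W = 32a2`: the small model that kills the
  crux as typed (class refuted-misstated; repair: hypothesis `¬ W.HasCM`).

Refuter seat refuter-rattack-stmt-BirchSwinnertonDyer-15532-0, 2026-08-16.
-/

noncomputable section

open scoped Classical MatrixGroups
open Matrix Polynomial

namespace Summit.BirchSwinnertonDyer.BirchSwinnertonDyer.Theorems

open WeierstrassCurve Literature.NumberTheory.EllipticCurves
  Literature.NumberTheory.GaloisRepresentations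

/-- Complex conjugation on `ℚ̄`: a square root `u` of `−1` is moved to `−u` by some
`σ ∈ Gal(ℚ̄/ℚ)` (`u` and `−u` are the roots of the irreducible `X² + 1 ∈ ℚ[X]`, hence conjugate:
`Normal.minpoly_eq_iff_mem_orbit`). [folklore] -/
theorem tamePinch_exists_smul_sqrt_neg_one_eq_neg {u : AlgebraicClosure ℚ} (hu : u ^ 2 = -1) :
    ∃ σ : Field.absoluteGaloisGroup ℚ, σ • u = -u := by
  have hXC : (X ^ 2 + 1 : ℚ[X]) = X ^ 2 + C 1 := by rw [C_1]
  have hdeg : (X ^ 2 + 1 : ℚ[X]).natDegree = 2 := by rw [hXC]; exact natDegree_X_pow_add_C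
  have hmonic : (X ^ 2 + 1 : ℚ[X]).Monic := by rw [hXC]; exact monic_X_pow_add_C 1 two_ne_zero
  have hirr : Irreducible (X ^ 2 + 1 : ℚ[X]) := by
    refine irreducible_of_degree_le_three_of_not_isRoot ?_ ?_
    · rw [hdeg]; decide
    · intro x hx
      have hx' : x ^ 2 + 1 = 0 := by simpa using hx
      nlinarith [sq_nonneg x]
  have h1 : (X ^ 2 + 1 : ℚ[X]) = minpoly ℚ u :=
    minpoly.eq_of_irreducible_of_monic hirr (by simp [hu]) hmonic
  have h2 : (X ^ 2 + 1 : ℚ[X]) = minpoly ℚ (-u) :=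
    minpoly.eq_of_irreducible_of_monic hirr (by simp [hu]) hmonic
  -- `ℚ̄/ℚ` is normal (instance supplied by hand: the `IsAlgClosure` instance is keyed on
  -- `AlgebraicClosure.instAlgebra`, defeq to `DivisionRing.toRatAlgebra` but not reducibly)
  haveI : Normal ℚ (AlgebraicClosure ℚ) :=
    @IsAlgClosure.normal ℚ (AlgebraicClosure ℚ) _ _ (AlgebraicClosure.instAlgebra ℚ) inferInstance
  obtain ⟨σ, hσ⟩ :=
    (Normal.minpoly_eq_iff_mem_orbit (F := ℚ) (E := AlgebraicClosure ℚ)).mp (h2.symm.trans h1)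
  exact ⟨σ, hσ⟩

/-- **No odd prime has surjective mod-`p` image on `y² = x³ + Dx`** (`D ≠ 0`; CM by `ℤ[i]`):
for every prime `p ≠ 2`, `ρ̄_{E_D,p} : Γ_ℚ → Aut(E_D[p])` is not onto. All squares of elements of
the image commute (they centralise the non-scalar `[i]|E[p]`), while the squares of the two
elementary unipotent matrices of `GL₂(𝔽_p)` do not (`4 ≠ 0`). Serre 1972 §4.5; Darmon–Merel 1997
Prop. 4.1 (1); Zywina 2015 Prop. 1.14. [folklore] -/
theorem tamePinch_not_hasSurjectiveModNGaloisRep_quartic {D : ℚ} (hD : D ≠ 0)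
    (p : ℕ) [Fact p.Prime] (hp2 : p ≠ 2) :
    ¬ (⟨0, 0, 0, D, 0⟩ : WeierstrassCurve ℚ).HasSurjectiveModNGaloisRep (p : ℤ) := by
  haveI := isElliptic_quartic hD
  set W : WeierstrassCurve ℚ := ⟨0, 0, 0, D, 0⟩ with hW
  have hpp : p.Prime := Fact.out
  -- `2 ≠ 0` and `4 ≠ 0` in `𝔽_p`
  have h2 : (2 : ZMod p) ≠ 0 := by
    intro h
    have h' : ((2 : ℕ) : ZMod p) = 0 := by exact_mod_cast h
    rw [ZMod.natCast_eq_zero_iff] at h'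
    exact hp2 ((Nat.prime_dvd_prime_iff_eq hpp Nat.prime_two).mp h')
  have h4 : (4 : ZMod p) ≠ 0 := by
    have : (4 : ZMod p) = 2 * 2 := by norm_num
    rw [this]; exact mul_ne_zero h2 h2
  intro hsurj
  -- a frame of `E[p]` and the CM automorphism `[i]`
  obtain ⟨e, Φ, heΦ, -, -⟩ := exists_frame_galoisRepTorsion_rat W p
  obtain ⟨u, hu⟩ := IsAlgClosed.exists_pow_nat_eq (-1 : AlgebraicClosure ℚ) (n := 2) two_pos
  obtain ⟨ι, hιι, hfix, hneg⟩ := exists_cmAut_quartic (D := D) hu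
  -- `ι` preserves `E[p]`; its restriction `T`
  have hmem : ∀ (f : geomPoints W ≃+ geomPoints W) (P : geomPoints W),
      P ∈ geomTorsion W p → f P ∈ geomTorsion W p := by
    intro f P hP
    have hP' : (p : ℤ) • P = 0 := (Submodule.mem_torsionBy_iff (p : ℤ) P).mp hP
    exact (Submodule.mem_torsionBy_iff (p : ℤ) (f P)).mpr (by rw [← map_zsmul f, hP', map_zero])
  let T : geomTorsion W p ≃+ geomTorsion W p :=
    { toFun := fun x ↦ ⟨ι x, hmem ι x x.2⟩
      invFun := fun x ↦ ⟨ι.symm x, hmem ι.symm x x.2⟩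
      left_inv := fun x ↦ Subtype.ext (ι.symm_apply_apply (x : geomPoints W))
      right_inv := fun x ↦ Subtype.ext (ι.apply_symm_apply (x : geomPoints W))
      map_add' := fun x y ↦ Subtype.ext (map_add ι (x : geomPoints W) y) }
  have hT : ∀ x : geomTorsion W p, ((T x : geomTorsion W p) : geomPoints W) = ι x := fun x ↦ rfl
  -- the matrices `t = Φ(T)` and `g σ = Φ(ρ̄ σ)`
  set t : Matrix (Fin 2) (Fin 2) (ZMod p) :=
    ((Φ (Multiplicative.ofAdd T) : GL (Fin 2) (ZMod p)) : Matrix (Fin 2) (Fin 2) (ZMod p)) with ht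
  set g : Field.absoluteGaloisGroup ℚ → Matrix (Fin 2) (Fin 2) (ZMod p) := fun σ ↦
    ((Φ (galoisRepTorsion W p σ) : GL (Fin 2) (ZMod p)) : Matrix (Fin 2) (Fin 2) (ZMod p)) with hg
  have heT : ∀ x : geomTorsion W p, e (T x) = t *ᵥ e x := fun x ↦ by
    simpa using heΦ (Multiplicative.ofAdd T) x
  have heσ : ∀ (σ : Field.absoluteGaloisGroup ℚ) (x : geomTorsion W p),
      e (σ • x) = g σ *ᵥ e x := fun σ x ↦ by
    simpa using heΦ (galoisRepTorsion W p σ) x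
  have hext : ∀ M N : Matrix (Fin 2) (Fin 2) (ZMod p),
      (∀ x : geomTorsion W p, M *ᵥ e x = N *ᵥ e x) → M = N := by
    intro M N h
    refine Matrix.toLin'.injective (LinearMap.ext fun v ↦ ?_)
    obtain ⟨x, rfl⟩ := e.surjective v
    simpa only [Matrix.toLin'_apply] using h x
  -- (M1) `t² = -1`
  have htt : t * t = -1 := by
    refine hext _ _ fun x ↦ ?_
    have hTT : T (T x) = -x := Subtype.ext (by rw [hT, hT, hιι]; rfl)
    rw [← Matrix.mulVec_mulVec, ← heT, ← heT, hTT, map_neg, Matrix.neg_mulVec, Matrix.one_mulVec]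
  -- (M2) `σ u = u`: `g σ` commutes with `t`; (M3) `σ u = -u`: it anti-commutes
  have hcomm : ∀ σ : Field.absoluteGaloisGroup ℚ, σ • u = u → g σ * t = t * g σ := by
    intro σ hσ
    refine hext _ _ fun x ↦ ?_
    have hσT : σ • T x = T (σ • x) := Subtype.ext (by
      show σ • ((T x : geomTorsion W p) : geomPoints W) = ι ((σ • x : geomTorsion W p) : geomPoints W)
      rw [hT]; exact hfix σ hσ x)
    simp only [← Matrix.mulVec_mulVec, ← heT, ← heσ, hσT]
  have hanti : ∀ σ : Field.absoluteGaloisGroup ℚ, σ • u = -u → g σ * t = -(t * g σ) := by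
    intro σ hσ
    refine hext _ _ fun x ↦ ?_
    have hσT : σ • T x = -T (σ • x) := Subtype.ext (by
      show σ • ((T x : geomTorsion W p) : geomPoints W) =
        -ι ((σ • x : geomTorsion W p) : geomPoints W)
      rw [hT]; exact hneg σ hσ x)
    simp only [Matrix.neg_mulVec, ← Matrix.mulVec_mulVec, ← heT, ← heσ, hσT, map_neg]
  -- the `g σ` are invertible, in particular non-zero
  have hgu : ∀ σ : Field.absoluteGaloisGroup ℚ, IsUnit (g σ).det := fun σ ↦ by
    simp only [hg, ← Matrix.GeneralLinearGroup.val_det_apply]; exact Units.isUnit _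
  have hg0 : ∀ σ : Field.absoluteGaloisGroup ℚ, g σ ≠ 0 := fun σ h ↦ by
    have := hgu σ
    rw [h, Matrix.det_zero] at this
    exact not_isUnit_zero this
  -- (C1) `t` is not a scalar: complex conjugation anti-commutes with it
  obtain ⟨σ₀, hσ₀⟩ := tamePinch_exists_smul_sqrt_neg_one_eq_neg hu
  have hts : ∀ c : ZMod p, t ≠ c • (1 : Matrix (Fin 2) (Fin 2) (ZMod p)) := by
    intro c hc
    have h := hanti σ₀ hσ₀
    rw [hc, Matrix.mul_smul, Matrix.mul_one, Matrix.smul_mul, Matrix.one_mul] at h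
    -- `c • g σ₀ = -(c • g σ₀)`, so `(2c) • g σ₀ = 0`, so `c = 0`
    have h' : (2 * c) • g σ₀ = 0 := by
      rw [mul_smul, two_smul]
      nth_rewrite 1 [h]
      rw [neg_add_cancel]
    rcases smul_eq_zero.mp h' with h'' | h''
    · rcases mul_eq_zero.mp h'' with h2' | hc0
      · exact h2 h2'
      · -- `t = 0`, contradicting `t² = -1`
        rw [hc0, zero_smul] at hc
        rw [hc, Matrix.mul_zero] at htt
        have h00 := congrFun (congrFun htt 0) 0
        simp at h00
    · exact hg0 σ₀ h''
  -- (C2) elements of the image at `σ` fixing `u` lie in `𝔽_p[t]`, hence commute pairwise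
  have hpair : ∀ σ τ : Field.absoluteGaloisGroup ℚ, σ • u = u → τ • u = u →
      g σ * g τ = g τ * g σ := by
    intro σ τ hσ hτ
    obtain ⟨a, b, hab⟩ :=
      DeligneSerre1974.TwoByTwo.exists_eq_smul_one_add_smul_of_commute hts (hcomm τ hτ).symm
    have hct : Commute (g σ) t := hcomm σ hσ
    have hc : Commute (g σ) (g τ) := by
      rw [hab]
      exact ((Commute.one_right _).smul_right a).add_right (hct.smul_right b)
    exact hc
  -- (C3) every square in `Γ_ℚ` fixes `u`
  have hsq : ∀ σ : Field.absoluteGaloisGroup ℚ, (σ * σ) • u = u := by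
    intro σ
    rcases smul_sqrt_neg_one_eq_or hu σ with h | h
    · rw [mul_smul, h, h]
    · rw [mul_smul, h, smul_neg, h, neg_neg]
  -- (C4) surjectivity: realise the two elementary unipotents and compare their squares
  let A : GL (Fin 2) (ZMod p) :=
    ⟨!![1, 1; 0, 1], !![1, -1; 0, 1], by simp [Matrix.one_fin_two], by simp [Matrix.one_fin_two]⟩
  let B : GL (Fin 2) (ZMod p) :=
    ⟨!![1, 0; 1, 1], !![1, 0; -1, 1], by simp [Matrix.one_fin_two], by simp [Matrix.one_fin_two]⟩
  obtain ⟨σA, hσA⟩ := hsurj (Φ.symm A)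
  obtain ⟨σB, hσB⟩ := hsurj (Φ.symm B)
  have hgA : g (σA * σA) = !![1, 1; 0, 1] * !![1, 1; 0, 1] := by
    simp only [hg, map_mul, hσA, MulEquiv.apply_symm_apply, Units.val_mul]
    rfl
  have hgB : g (σB * σB) = !![1, 0; 1, 1] * !![1, 0; 1, 1] := by
    simp only [hg, map_mul, hσB, MulEquiv.apply_symm_apply, Units.val_mul]
    rfl
  have hA2 : (!![1, 1; 0, 1] * !![1, 1; 0, 1] : Matrix (Fin 2) (Fin 2) (ZMod p)) = !![1, 2; 0, 1] := by
    rw [Matrix.mul_fin_two]; norm_num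
  have hB2 : (!![1, 0; 1, 1] * !![1, 0; 1, 1] : Matrix (Fin 2) (Fin 2) (ZMod p)) = !![1, 0; 2, 1] := by
    rw [Matrix.mul_fin_two]; norm_num
  have key := hpair (σA * σA) (σB * σB) (hsq σA) (hsq σB)
  rw [hgA, hgB, hA2, hB2, Matrix.mul_fin_two, Matrix.mul_fin_two] at key
  -- compare the `(0,0)` entries: `1·1 + 2·2 = 1·1 + 0·2`, i.e. `4 = 0` in `𝔽_p`
  have h00 := congrFun (congrFun key 0) 0
  simp only [Matrix.of_apply, Matrix.cons_val_zero] at h00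
  apply h4
  linear_combination h00

/-- The integral model `[0,0,0,−1,0]` of `y² = x³ − x` base-changes to the rational one. [folklore] -/
theorem tamePinch_baseChange_thirtyTwoA2 :
    ((⟨0, 0, 0, -1, 0⟩ : WeierstrassCurve ℤ).baseChange ℚ) = (⟨0, 0, 0, -1, 0⟩ : WeierstrassCurve ℚ) := by
  simp only [WeierstrassCurve.baseChange, WeierstrassCurve.map]
  ext <;> simp

/-- `y² = x³ − x` (Cremona 32a2, `Δ = 64 = 2⁶`) is a global minimal model: `p¹² ∤ 64` for every
prime `p` (Silverman AEC VII.1 Remark 1.1). [folklore] -/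
theorem tamePinch_isGloballyMinimal_thirtyTwoA2 :
    (⟨0, 0, 0, -1, 0⟩ : WeierstrassCurve ℚ).IsGloballyMinimal := by
  rw [← tamePinch_baseChange_thirtyTwoA2]
  refine isGloballyMinimal_of_forall_isMinimalAt_int _ fun v ↦ ?_
  refine isMinimalAt_baseChange_int_of_not_pow_dvd_Δ ?_
  intro h
  have hΔ : (⟨0, 0, 0, -1, 0⟩ : WeierstrassCurve ℤ).Δ = 64 := by
    simp only [WeierstrassCurve.Δ, WeierstrassCurve.b₂, WeierstrassCurve.b₄, WeierstrassCurve.b₆,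
      WeierstrassCurve.b₈]
    norm_num
  rw [hΔ] at h
  have hp := Rat.HeightOneSpectrum.prime_natGenerator v
  have h' : Rat.HeightOneSpectrum.natGenerator v ^ 12 ∣ 64 := by exact_mod_cast h
  have hle : Rat.HeightOneSpectrum.natGenerator v ^ 12 ≤ 64 := Nat.le_of_dvd (by norm_num) h'
  have hge : 2 ^ 12 ≤ Rat.HeightOneSpectrum.natGenerator v ^ 12 := Nat.pow_le_pow_left hp.two_le 12
  have := hge.trans hle
  norm_num at this

/-- **The admissible-prime clause of `TamePinch` fails at `32a2`.** There is no prime `p ≥ 5`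
with `W.HasSurjectiveModNGaloisRep p` for `W = [0,0,0,−1,0]` (`y² = x³ − x`, CM by `ℤ[i]`); this is
the small model behind `LeadingTermTamePinch_refuted` (the crux as typed quantifies over CM
curves; repair: add the hypothesis `¬ W.HasCM`). [folklore] -/
theorem tamePinch_no_admissible_prime_thirtyTwoA2 :
    ¬ ∃ (p : ℕ) (_ : Fact p.Prime), 5 ≤ p ∧
      (⟨0, 0, 0, -1, 0⟩ : WeierstrassCurve ℚ).HasSurjectiveModNGaloisRep (p : ℤ) := by
  rintro ⟨p, hp, h5, hsurj⟩
  exact tamePinch_not_hasSurjectiveModNGaloisRep_quartic (D := -1) (by norm_num) p (by omega) hsurj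

end Summit.BirchSwinnertonDyer.BirchSwinnertonDyer.Theorems

end
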